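import Summits.AtomisticToContinuum.HydrodynamicLimit.Theorems.OneFlightGossipEngineCollisionActivityTailsOwnBirthThinning
import HarnessLib

/-!
# `CollisionActivityTails` (stmt-AtomisticToContinuum-13734), line `plaque-thinning-count-ld`:
# the COLD REGIME of own-birth thinning — below catch radius `3ε` the aiming terms vanish identically

Helper file (`--supports stmt-AtomisticToContinuum-13734`) for the crux
`Summit.AtomisticToContinuum.HydrodynamicLimit.Theses.OneFlightGossipEngine.CollisionActivityTails`, skeleton line
`plaque-thinning-count-ld` (v11, lead c6-0, cycle 2), vocabulary of `…Theorems.CollisionActivityTailsOwnBirthThinning` (p131231).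

Kernel-checked certificate of §2a of the lead's audit of the cycle-1 stub `stub_equilibriumUntaggedLMGF` (`audit-stub2-c6.md`, crux
evidence): at a NORMAL birth of a shooter `k` (in particular `nearCount_k(3ε) ≤ 2`: only `k` and its partner within `3ε`) there is NO
admissible target `j ∉ {k, partner}` within distance `ϱ < 3ε` of `x_k` — `k`, its partner (at contact distance `ε`) and `j` would be
three centres within `3ε`. Hence for catch radii `ϱ < 3ε`:

* `aimedBirths_eq_zero_of_lt` — the aimed-normal-birth count vanishes identically, for EVERY pair set `P`, every window, every datum;
* `guardedWeight_eq_zero` — so does every weight guarded like the skeleton's aiming mass `aimMassAt` (the compensator of the one-flight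
  aiming supermartingale is `0`: the ex-stub-1 inequality is void there);
* `collCount_le_of_coldRegime` — own-birth thinning (landed `stub_ownBirthThinning`) then reads
  `collCount_i(0, τℓ] ≤ 1 + τ/ϑ + abnormalCount_i(0, (τ+ϑ)ℓ]`: in the cold regime `uϑ < σ` (`coldRegime_iff`) thinning is ENTIRELY a
  statement about ABNORMAL (crowded / gentle / fast-marked / short-incoming) births — the recurrence statistic that no static estimate and
  no isotropy supermartingale prices (the reason v11 registers the joint untagged tail 2j as the line's open input).

Elementary (finite-set counting on the landed vocabulary); recorded here because the line's composition decisions rest on it.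
-/

noncomputable section

open MeasureTheory Set Filter Topology
open scoped ENNReal

namespace Summit.AtomisticToContinuum.HydrodynamicLimit.Theorems.CollisionActivityTailsOwnBirthThinning

open Literature.MathematicalPhysics.KineticTheory Literature.Analysis.FluidPDE
open Summit.AtomisticToContinuum.HydrodynamicLimit.Theorems.CollisionActivityTailsActivityDomination
  (Flow Cfg window act tdist nearCount)

variable {σ : ℝ} {N : ℕ}

/-! ## §1 Distances at a birth -/

/-- A participating particle is at contact distance `ε` from its partner (`tdist` is the minimal-image distance `Torus.euclidDist`,
symmetric: `CollisionActivityTailsContact.tdist_comm`). -/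
theorem tdist_partner_eq {ε : ℝ} {y : Cfg N} {k : Fin (N + 1)} (hk : Participates G3 ε y k) :
    tdist (y (partner G3 ε y k)).1 (y k).1 = ε := by
  rcases collide_partner hk with h | h
  · have h' : Torus.euclidDist (y k).1 (y (partner G3 ε y k)).1 = ε := (mem_contactSet.1 (mem_contactPairs.1 h).2).2
    calc tdist (y (partner G3 ε y k)).1 (y k).1 = Torus.euclidDist (y (partner G3 ε y k)).1 (y k).1 := rfl
      _ = Torus.euclidDist (y k).1 (y (partner G3 ε y k)).1 := Torus.euclidDist_comm _ _
      _ = ε := h'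
  · exact (mem_contactSet.1 (mem_contactPairs.1 h).2).2

/-- The partner of a participating particle is another particle. -/
theorem partner_ne_self {ε : ℝ} {y : Cfg N} {k : Fin (N + 1)} (hk : Participates G3 ε y k) :
    partner G3 ε y k ≠ k :=
  (Collide.ne (collide_partner hk)).symm

/-- **No admissible target below `3ε` at an unshadowed birth.** If `k` participates in a collision, at most two centres lie within
`3ε` of `x_k`, and `j ∉ {k, partner k}` lies within `ϱ < 3ε` of `x_k` — contradiction (`k`, its partner and `j` are three such centres). -/
theorem not_target_of_nearCount_le_two {ε ϱ : ℝ} (hϱ : ϱ < 3 * ε) {y : Cfg N} {k j : Fin (N + 1)}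
    (hk : Participates G3 ε y k) (hnc : nearCount y k (3 * ε) ≤ 2) (hjk : j ≠ k) (hjp : j ≠ partner G3 ε y k)
    (hdist : tdist (y j).1 (y k).1 ≤ ϱ) : False := by
  classical
  set p := partner G3 ε y k with hp
  have hpk : p ≠ k := partner_ne_self hk
  have hpε : tdist (y p).1 (y k).1 = ε := tdist_partner_eq hk
  have hε : 0 ≤ ε := by rw [← hpε]; exact norm_nonneg _
  have hsub : ({k, p, j} : Finset (Fin (N + 1))) ⊆
      Finset.univ.filter (fun m : Fin (N + 1) => tdist (y m).1 (y k).1 ≤ 3 * ε) := by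
    intro m hm
    simp only [Finset.mem_insert, Finset.mem_singleton] at hm
    rw [Finset.mem_filter]
    refine ⟨Finset.mem_univ _, ?_⟩
    rcases hm with rfl | rfl | rfl
    · have h0 : tdist (y m).1 (y m).1 = 0 := Torus.euclidDist_self _
      rw [h0]; positivity
    · rw [hpε]; linarith
    · linarith
  have hcard : ({k, p, j} : Finset (Fin (N + 1))).card = 3 := by
    rw [Finset.card_insert_of_notMem, Finset.card_insert_of_notMem, Finset.card_singleton]
    · simpa using hjp.symm
    · simp only [Finset.mem_insert, Finset.mem_singleton, not_or]
      exact ⟨hpk.symm, hjk.symm⟩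
  have h3 : 3 ≤ nearCount y k (3 * ε) := by
    change 3 ≤ (Finset.univ.filter fun m : Fin (N + 1) => tdist (y m).1 (y k).1 ≤ 3 * ε).card
    calc 3 = ({k, p, j} : Finset (Fin (N + 1))).card := hcard.symm
      _ ≤ _ := Finset.card_le_card hsub
  omega

/-! ## §2 The aiming terms vanish below `3ε` -/

/-- At a normal birth (a collision time of `k` with `nearCount_k(3ε) ≤ 2`) `k` is aimed at nobody within `ϱ < 3ε`. -/
theorem not_isAimedAt_of_normal {ε ϱ u M₀ L₀ : ℝ} (hϱ : ϱ < 3 * ε) {γ : ℝ → Cfg N} {k j : Fin (N + 1)} {t : ℝ}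
    (hk : Participates G3 ε (γ t) k) (hn : IsNormalBirth ε u M₀ L₀ γ k t) : ¬ IsAimedAt ε ϱ u (γ t) k j := by
  rintro ⟨hjk, hjp, hdist, -, -⟩
  obtain ⟨-, -, -, hnc, -⟩ := hn
  exact not_target_of_nearCount_le_two hϱ hk hnc hjk hjp hdist

/-- **COLD REGIME, I: the aimed-normal-birth count vanishes identically** for catch radii `ϱ < 3ε` — every pair set, every window,
every datum (good or not: each summand is indexed by a collision time of its shooter). -/
theorem aimedBirths_eq_zero_of_lt {ε ϱ u M₀ L₀ : ℝ} (hϱ : ϱ < 3 * ε) (Φ : Flow σ N) (S : Set ℝ)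
    (P : Finset (Fin (N + 1) × Fin (N + 1))) (z : Cfg N) :
    aimedBirths ε ϱ u M₀ L₀ Φ S P z = 0 := by
  classical
  unfold aimedBirths
  refine Finset.sum_eq_zero fun k _ => finsum_mem_of_eqOn_zero fun t ht => ?_
  rw [Pi.zero_apply, if_neg]
  rintro ⟨hn, j, -, hj⟩
  exact not_isAimedAt_of_normal hϱ (mem_collisionTimesOf.1 ht.1) hn hj

/-- **COLD REGIME, II: every target-guarded weight vanishes** at an unshadowed birth for `ϱ < 3ε` — the shape of the skeleton's aiming
mass `aimMassAt ε ϱ u y k j = if j ≠ k ∧ j ≠ partner ∧ tdist ≤ ϱ ∧ ‖v_j‖ ≤ u then aimProb … else 0`, so the compensator of the one-flight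
aiming supermartingale (ex-stub 1) is identically `0` there and its inequality void. -/
theorem guardedWeight_eq_zero {ε ϱ : ℝ} (hϱ : ϱ < 3 * ε) {y : Cfg N} {k j : Fin (N + 1)} (hk : Participates G3 ε y k)
    (hnc : nearCount y k (3 * ε) ≤ 2) (Q : Prop) [Decidable (j ≠ k ∧ j ≠ partner G3 ε y k ∧ tdist (y j).1 (y k).1 ≤ ϱ ∧ Q)]
    (w : ℝ) :
    (if j ≠ k ∧ j ≠ partner G3 ε y k ∧ tdist (y j).1 (y k).1 ≤ ϱ ∧ Q then w else 0) = 0 := by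
  rw [if_neg]
  rintro ⟨hjk, hjp, hd, -⟩
  exact not_target_of_nearCount_le_two hϱ hk hnc hjk hjp hd

/-! ## §3 Own-birth thinning in the cold regime -/

/-- **COLD REGIME, III: own-birth thinning without aiming.** On the good set, with the hypotheses of `OwnBirthThinning` and a catch
radius `ϱℓ < 3ε`: `collCount_i(0, τℓ] ≤ 1 + τ/ϑ + abnormalCount_i(0, (τ+ϑ)ℓ]` — all short flights are charged to ABNORMAL births. -/
theorem collCount_le_of_coldRegime (Φ : Flow σ N) {z : Cfg N} (hz : z ∈ Φ.good) (hσ : 0 < σ) (i : Fin (N + 1))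
    {τ ϑ ϱ u M₀ L₀ : ℝ} (hτ : 0 < τ) (hϑ : 0 < ϑ) (hu : 0 < u)
    (hϱ : hsDiameter σ N + 2 * u * window ϑ N ≤ ϱ * ((N : ℝ) + 1) ^ (-(1 / 3 : ℝ)))
    (hwrap : 4 * u * window ϑ N + 2 * (ϱ * ((N : ℝ) + 1) ^ (-(1 / 3 : ℝ))) < 2⁻¹)
    (hcold : ϱ * ((N : ℝ) + 1) ^ (-(1 / 3 : ℝ)) < 3 * hsDiameter σ N) :
    collCount Φ (Set.Ioc 0 (window τ N)) i z ≤
      1 + τ / ϑ + abnormalCount (hsDiameter σ N) (ϱ * ((N : ℝ) + 1) ^ (-(1 / 3 : ℝ))) u M₀ L₀ Φ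
        (Set.Ioc 0 (window (τ + ϑ) N)) i z := by
  have h := stub_ownBirthThinning σ N Φ z hz hσ i τ ϑ ϱ u M₀ L₀ hτ hϑ hu hϱ hwrap
  rwa [aimedBirths_eq_zero_of_lt hcold, add_zero] at h

/-- `ε_N = σ ℓ_N` with `ℓ_N = (N+1)^{-1/3}` written over the real cast of `N`. -/
theorem hsDiameter_eq_mul (σ : ℝ) (N : ℕ) : hsDiameter σ N = σ * ((N : ℝ) + 1) ^ (-(1 / 3 : ℝ)) := by
  unfold hsDiameter
  push_cast
  rfl

/-- **The cold regime is `uϑ < σ`.** With the minimal catch radius `ϱ := σ + 2uϑ` (so that `ϱℓ = ε + 2uϑℓ`, equality in the first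
hypothesis of own-birth thinning), the cold-regime condition `ϱℓ < 3ε` holds iff `u ϑ < σ`. -/
theorem coldRegime_iff {u ϑ : ℝ} (σ : ℝ) (N : ℕ) :
    (σ + 2 * u * ϑ) * ((N : ℝ) + 1) ^ (-(1 / 3 : ℝ)) < 3 * hsDiameter σ N ↔ u * ϑ < σ := by
  have hℓ : 0 < ((N : ℝ) + 1) ^ (-(1 / 3 : ℝ)) := Real.rpow_pos_of_pos (by positivity) _
  rw [hsDiameter_eq_mul σ N]
  constructor
  · intro h; nlinarith
  · intro h; nlinarith

/-- The minimal catch radius meets the first hypothesis of own-birth thinning with equality: `ε + 2u·(ϑℓ) = (σ + 2uϑ)ℓ`. -/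
theorem minimalCatch_eq {u ϑ : ℝ} (σ : ℝ) (N : ℕ) :
    hsDiameter σ N + 2 * u * window ϑ N = (σ + 2 * u * ϑ) * ((N : ℝ) + 1) ^ (-(1 / 3 : ℝ)) := by
  rw [hsDiameter_eq_mul σ N, show window ϑ N = ϑ * ((N : ℝ) + 1) ^ (-(1 / 3 : ℝ)) from rfl]
  ring

/-- **Registered helper sub-goal `stub_coldRegimeThinning`** (line `plaque-thinning-count-ld`): own-birth thinning without aiming below catch radius `3ε` (`collCount_le_of_coldRegime`). -/
theorem stub_coldRegimeThinning : ∀ (σ : ℝ) (N : ℕ) (Φ : Flow σ N) (z : Cfg N), z ∈ Φ.good → 0 < σ → ∀ (i : Fin (N + 1)) (τ ϑ ϱ u M₀ L₀ : ℝ), 0 < τ → 0 < ϑ → 0 < u → hsDiameter σ N + 2 * u * window ϑ N ≤ ϱ * ((N : ℝ) + 1) ^ (-(1 / 3 : ℝ)) → 4 * u * window ϑ N + 2 * (ϱ * ((N : ℝ) + 1) ^ (-(1 / 3 : ℝ))) < 2⁻¹ → ϱ * ((N : ℝ) + 1) ^ (-(1 / 3 : ℝ)) < 3 * hsDiameter σ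 N → collCount Φ (Set.Ioc 0 (window τ N)) i z ≤ 1 + τ / ϑ + abnormalCount (hsDiameter σ N) (ϱ * ((N : ℝ) + 1) ^ (-(1 / 3 : ℝ))) u M₀ L₀ Φ (Set.Ioc 0 (window (τ + ϑ) N)) i z :=
  fun _ _ Φ _ hz hσ i _ _ _ _ _ _ hτ hϑ hu hϱ hwrap hcold => collCount_le_of_coldRegime Φ hz hσ i hτ hϑ hu hϱ hwrap hcold

end Summit.AtomisticToContinuum.HydrodynamicLimit.Theorems.CollisionActivityTailsOwnBirthThinning

end
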